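import Mathlib
import Summits.NavierStokesRegularity.NavierStokesRegularity.Theorems.EulerZoomLiouvillePowerGaugeEulerLiouvilleDriftClockPerigee
import Summits.NavierStokesRegularity.NavierStokesRegularity.Theorems.EulerZoomLiouvillePowerGaugeEulerLiouvilleNeedleClockLocal
import Summits.NavierStokesRegularity.NavierStokesRegularity.Theorems.EulerZoomLiouvillePowerGaugeEulerLiouvilleCondenserMinimalType
import Summits.NavierStokesRegularity.NavierStokesRegularity.Theorems.EulerZoomLiouvillePowerGaugeEulerLiouvilleSelfSimilarPastStrata
import HarnessLib

/-!
# «NO APOGEE, NO HOVERING, NO SPIKE» members (T-D, pointwise form): centred and past-exact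
# (crux `EulerZoomLiouville.PowerGaugeEulerLiouville` = stmt-NavierStokesRegularity-19832, THE ONE STATEMENT `stub_selfSimilarC2Needle`; via `HasResidenceClock` alt 6 «one clocked ball»)

Route `EulerZoomLiouville` (NavierStokesRegularity), crux E; width seat ns-ezl-w1 g6.  By-name assembly of the class-free clock
`DriftClock.powerClockAt_of_perigee_fast_envelope` (`…DriftClockPerigee`) with the LEAD's local thresholds
`NeedleRace.selfSimilar_ae_eq_zero_of_localPowerClockC2` / `…_past` over a classical pressure of the profile.  Notation: `W y = γy + V y`, `γ = 1/(2+ρ)`,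
`ℛ(y) = ⟪y, W y⟫`, `a(y) = ‖W y‖² + γℛ(y) + ⟪y, DV(y)(W y)⟫`, `ℋ = ℋ_{P′}`.

* **`Loc.selfSimilar_ae_eq_zero_of_perigeeFastEnvelopeC2_level`** — crux hypotheses (`0 < ρ ≤ ½`), exact self-similarity about the origin, `V ∈ C²`, and for every
  classical pressure `P′`: SOME vortical `x₀`, SOME level `h < ℋ(x₀)`, and beyond some radius, at the vortical points of `{ℋ > h}`: (P) `ℛ = 0 ⇒ a > 0` (no apogee),
  (F) `ℛ ≤ 0 ⇒ ‖W‖ ≥ w₀` for one `w₀ > 0` (no inflow hovering), (E) `ℋ(y) − ℋ(y′) ≤ C r^θ` on `‖y‖, ‖y′‖ ≤ r` for one `C` and one `θ < 2+ρ` (no spike)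
  ⇒ `u = 0` a.e. on the slab.
* **`Past.selfSimilar_ae_eq_zero_of_perigeeFastEnvelopeC2_level_past`** — the same for members exactly self-similar about `(T, x₀)` for `τ < T₁` only.

THE NEEDLE'S FACE after this (negation, for every classical `P′`, every vortical `x₀`, every `h < ℋ(x₀)`): beyond every radius the vortical part of `{ℋ > h}`
carries an APOGEE-TYPE CIRCULAR point (`ℛ = 0`, `a ≤ 0`), or inflow points with `‖W‖` arbitrarily small (HOVERING), or Bernoulli oscillations `≥ C r^θ` on
`B̄(0, r)` for every `C`, `θ < 2+ρ` (SPIKES).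
WHAT THIS IS NOT: not NS, not E — strata on the model lattice; DENT 0 on the registered stubs; 19832 OPEN; NS regularity is NOT proved; no summit statement is
proved by this seat. [folklore; ConstantinIgnatovaVicol2026Putative §3.4–§3.5]
-/
noncomputable section

-- flat `Theorems/<Route><Decl>…` files of one crux share the namespace of the crux (tree convention: `Summit.<S>.<S>.…`)
set_option linter.dupNamespace false

open Set Filter Topology Metric Function MeasureTheory
open scoped RealInnerProductSpace NNReal ENNReal

namespace Summit.NavierStokesRegularity.NavierStokesRegularity.Theorems.PowerGaugeEulerLiouville

open Literature.Analysis Literature.Analysis.FluidPDE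

/-- **EXACTLY SELF-SIMILAR MEMBERS WITHOUT APOGEES, INFLOW HOVERING AND BERNOULLI SPIKES ABOVE ONE LEVEL THROUGH ONE VORTICAL POINT ARE TRIVIAL** (crux hypotheses
verbatim, `0 < ρ ≤ ½`, exact self-similarity about the origin, `V ∈ C²`).  Proof = classical pressure ⇒ `DriftClock.powerClockAt_of_perigee_fast_envelope`
⇒ `NeedleRace.selfSimilar_ae_eq_zero_of_localPowerClockC2` («one clocked ball kills»). [folklore; ConstantinIgnatovaVicol2026Putative §3.4–§3.5] -/
theorem Loc.selfSimilar_ae_eq_zero_of_perigeeFastEnvelopeC2_level {ρ : ℝ} (hρ : 0 < ρ) (hρ1 : ρ ≤ 1 / 2)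
    {u : ℝ → EuclideanSpace ℝ (Fin 3) → EuclideanSpace ℝ (Fin 3)} {p : ℝ → EuclideanSpace ℝ (Fin 3) → ℝ}
    {H : ℝ → EuclideanSpace ℝ (Fin 3) → EuclideanSpace ℝ (Fin 3) →L[ℝ] EuclideanSpace ℝ (Fin 3)} {c : ℝ≥0}
    (hsw : IsSuitableWeakSolutionOn (slab (EuclideanSpace ℝ (Fin 3)) (Iio 0) isOpen_Iio) 0 0 u p)
    (hH : HasWeakSpatialGradientOn (slab (EuclideanSpace ℝ (Fin 3)) (Iio 0) isOpen_Iio) u H)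
    (hgauge : ∀ a : ℝ, 0 < a →
      ENNReal.ofReal (a ^ (2 * ρ)) * cknA a (0 : ℝ × EuclideanSpace ℝ (Fin 3)) u +
          ENNReal.ofReal (a ^ ρ) * cknE a (0 : ℝ × EuclideanSpace ℝ (Fin 3)) H +
        ENNReal.ofReal (a ^ (2 * ρ)) * cknD a (0 : ℝ × EuclideanSpace ℝ (Fin 3)) p ≤ (c : ℝ≥0∞))
    {V : EuclideanSpace ℝ (Fin 3) → EuclideanSpace ℝ (Fin 3)} {P : EuclideanSpace ℝ (Fin 3) → ℝ}
    (hu : ∀ τ : ℝ, τ < 0 → u τ = selfSimilarCollapse (1 / (2 + ρ)) 0 V τ)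
    (hp : ∀ τ : ℝ, τ < 0 → p τ = selfSimilarCollapsePressure (1 / (2 + ρ)) 0 P τ)
    (hV : ContDiff ℝ 2 V)
    (hB : ∀ P' : EuclideanSpace ℝ (Fin 3) → ℝ, IsSelfSimilarEulerProfile (1 / (2 + ρ)) 0 V P' →
      ∃ x₀ : EuclideanSpace ℝ (Fin 3), curl V x₀ ≠ 0 ∧ ∃ h : ℝ, h < selfSimilarBernoulli (1 / (2 + ρ)) 0 V P' x₀ ∧
        (∃ R₀ : ℝ, ∀ y : EuclideanSpace ℝ (Fin 3), R₀ ≤ ‖y‖ → h < selfSimilarBernoulli (1 / (2 + ρ)) 0 V P' y → curl V y ≠ 0 →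
          ⟪y, selfSimilarTransport (1 / (2 + ρ)) 0 V y⟫ = 0 →
          0 < ‖selfSimilarTransport (1 / (2 + ρ)) 0 V y‖ ^ 2 + (1 / (2 + ρ)) * ⟪y, selfSimilarTransport (1 / (2 + ρ)) 0 V y⟫ +
            ⟪y, fderiv ℝ V y (selfSimilarTransport (1 / (2 + ρ)) 0 V y)⟫) ∧
        (∃ w₀ : ℝ, 0 < w₀ ∧ ∃ R₀ : ℝ, ∀ y : EuclideanSpace ℝ (Fin 3), R₀ ≤ ‖y‖ → h < selfSimilarBernoulli (1 / (2 + ρ)) 0 V P' y → curl V y ≠ 0 →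
          ⟪y, selfSimilarTransport (1 / (2 + ρ)) 0 V y⟫ ≤ 0 → w₀ ≤ ‖selfSimilarTransport (1 / (2 + ρ)) 0 V y‖) ∧
        (∃ C θ R₀ : ℝ, θ < 2 + ρ ∧ ∀ (r : ℝ) (y y' : EuclideanSpace ℝ (Fin 3)), R₀ ≤ ‖y‖ → ‖y‖ ≤ r → R₀ ≤ ‖y'‖ → ‖y'‖ ≤ r →
          h < selfSimilarBernoulli (1 / (2 + ρ)) 0 V P' y → curl V y ≠ 0 → h < selfSimilarBernoulli (1 / (2 + ρ)) 0 V P' y' → curl V y' ≠ 0 →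
          selfSimilarBernoulli (1 / (2 + ρ)) 0 V P' y - selfSimilarBernoulli (1 / (2 + ρ)) 0 V P' y' ≤ C * r ^ θ)) :
    uncurry u =ᵐ[volume.restrict (Iio (0 : ℝ) ×ˢ (univ : Set (EuclideanSpace ℝ (Fin 3))))] 0 := by
  have hρ1' : ρ < 1 := by linarith
  -- ### a classical pressure for the profile
  have hD : ∀ a : ℝ, 0 < a → ENNReal.ofReal (a ^ (2 * ρ)) *
      cknD a (0 : ℝ × EuclideanSpace ℝ (Fin 3)) p ≤ (c : ℝ≥0∞) :=
    fun a ha => le_trans le_add_self (hgauge a ha)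
  have hpm : AEStronglyMeasurable (uncurry p)
      (volume.restrict (Iio (0 : ℝ) ×ˢ (univ : Set (EuclideanSpace ℝ (Fin 3))))) := by
    have := hsw.distributional.2.2.1.aestronglyMeasurable
    simpa [slab] using this
  have hPm := aestronglyMeasurable_pressureProfile hpm hp
  have hDprof := profile_pressure_weight_of_gaugeD hρ hρ1' hpm hp hD
  have hP1 : LocallyIntegrable P volume :=
    EnergySaturation.locallyIntegrable_pressure_of_weight hρ1' hPm
      (ENNReal.mul_ne_top ENNReal.ofReal_ne_top ENNReal.coe_ne_top) hDprof
  obtain ⟨P', hprof⟩ :=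
    WeakToClassical.exists_isSelfSimilarEulerProfile_of_contDiff hsw.distributional hu hp hV hP1
  -- ### the vortical point, its level, and the clock at that point
  obtain ⟨x₀, hx₀, h, hh, hper, hfast, henv⟩ := hB P' hprof
  have hclock := DriftClock.powerClockAt_of_perigee_fast_envelope hρ hρ1 hprof hx₀ hh hper hfast henv
  -- ### «one clocked ball kills»
  exact NeedleRace.selfSimilar_ae_eq_zero_of_localPowerClockC2 hρ hρ1 hsw hH hgauge hu hp hV
    (fun c' hc' => ⟨x₀, hclock c' hc'⟩)

namespace Past

variable {ρ T T₁ : ℝ}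
  {u : ℝ → EuclideanSpace ℝ (Fin 3) → EuclideanSpace ℝ (Fin 3)} {p : ℝ → EuclideanSpace ℝ (Fin 3) → ℝ}
  {H : ℝ → EuclideanSpace ℝ (Fin 3) → EuclideanSpace ℝ (Fin 3) →L[ℝ] EuclideanSpace ℝ (Fin 3)} {c : ℝ≥0}
  {V : EuclideanSpace ℝ (Fin 3) → EuclideanSpace ℝ (Fin 3)} {P : EuclideanSpace ℝ (Fin 3) → ℝ}

/-- **PAST-EXACT MEMBER WITHOUT APOGEES, INFLOW HOVERING AND BERNOULLI SPIKES ABOVE ONE LEVEL THROUGH ONE VORTICAL POINT IS TRIVIAL** (crux hypotheses verbatim,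
`0 < ρ ≤ ½`; exact self-similarity about `(T, x₀)` for `τ < T₁`, `T₁ ≤ 0`, `T₁ ≤ T`; `V ∈ C²`; the vortical point of the profile is `x₁`).  Proof =
`Past.exists_isSelfSimilarEulerProfile` ⇒ `DriftClock.powerClockAt_of_perigee_fast_envelope` ⇒ `NeedleRace.selfSimilar_ae_eq_zero_of_localPowerClockC2_past`.
[folklore; ConstantinIgnatovaVicol2026Putative §3.4–§3.5] -/
theorem selfSimilar_ae_eq_zero_of_perigeeFastEnvelopeC2_level_past (hρ : 0 < ρ) (hρh : ρ ≤ 1 / 2) (hT₁ : T₁ ≤ 0)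
    (hTT₁ : T₁ ≤ T) (x₀ : EuclideanSpace ℝ (Fin 3))
    (hsw : IsSuitableWeakSolutionOn (slab (EuclideanSpace ℝ (Fin 3)) (Iio 0) isOpen_Iio) 0 0 u p)
    (hH : HasWeakSpatialGradientOn (slab (EuclideanSpace ℝ (Fin 3)) (Iio 0) isOpen_Iio) u H)
    (hgauge : ∀ a : ℝ, 0 < a →
      ENNReal.ofReal (a ^ (2 * ρ)) * cknA a (0 : ℝ × EuclideanSpace ℝ (Fin 3)) u +
          ENNReal.ofReal (a ^ ρ) * cknE a (0 : ℝ × EuclideanSpace ℝ (Fin 3)) H +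
        ENNReal.ofReal (a ^ (2 * ρ)) * cknD a (0 : ℝ × EuclideanSpace ℝ (Fin 3)) p ≤ (c : ℝ≥0∞))
    (hu : ∀ τ : ℝ, τ < T₁ → u τ = fun x => selfSimilarCollapse (1 / (2 + ρ)) T V τ (x - x₀))
    (hp : ∀ τ : ℝ, τ < T₁ → p τ = fun x => selfSimilarCollapsePressure (1 / (2 + ρ)) T P τ (x - x₀))
    (hV : ContDiff ℝ 2 V)
    (hB : ∀ P' : EuclideanSpace ℝ (Fin 3) → ℝ, IsSelfSimilarEulerProfile (1 / (2 + ρ)) 0 V P' →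
      ∃ x₁ : EuclideanSpace ℝ (Fin 3), curl V x₁ ≠ 0 ∧ ∃ h : ℝ, h < selfSimilarBernoulli (1 / (2 + ρ)) 0 V P' x₁ ∧
        (∃ R₀ : ℝ, ∀ y : EuclideanSpace ℝ (Fin 3), R₀ ≤ ‖y‖ → h < selfSimilarBernoulli (1 / (2 + ρ)) 0 V P' y → curl V y ≠ 0 →
          ⟪y, selfSimilarTransport (1 / (2 + ρ)) 0 V y⟫ = 0 →
          0 < ‖selfSimilarTransport (1 / (2 + ρ)) 0 V y‖ ^ 2 + (1 / (2 + ρ)) * ⟪y, selfSimilarTransport (1 / (2 + ρ)) 0 V y⟫ +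
            ⟪y, fderiv ℝ V y (selfSimilarTransport (1 / (2 + ρ)) 0 V y)⟫) ∧
        (∃ w₀ : ℝ, 0 < w₀ ∧ ∃ R₀ : ℝ, ∀ y : EuclideanSpace ℝ (Fin 3), R₀ ≤ ‖y‖ → h < selfSimilarBernoulli (1 / (2 + ρ)) 0 V P' y → curl V y ≠ 0 →
          ⟪y, selfSimilarTransport (1 / (2 + ρ)) 0 V y⟫ ≤ 0 → w₀ ≤ ‖selfSimilarTransport (1 / (2 + ρ)) 0 V y‖) ∧
        (∃ C θ R₀ : ℝ, θ < 2 + ρ ∧ ∀ (r : ℝ) (y y' : EuclideanSpace ℝ (Fin 3)), R₀ ≤ ‖y‖ → ‖y‖ ≤ r → R₀ ≤ ‖y'‖ → ‖y'‖ ≤ r →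
          h < selfSimilarBernoulli (1 / (2 + ρ)) 0 V P' y → curl V y ≠ 0 → h < selfSimilarBernoulli (1 / (2 + ρ)) 0 V P' y' → curl V y' ≠ 0 →
          selfSimilarBernoulli (1 / (2 + ρ)) 0 V P' y - selfSimilarBernoulli (1 / (2 + ρ)) 0 V P' y' ≤ C * r ^ θ)) :
    uncurry u =ᵐ[volume.restrict (Iio (0 : ℝ) ×ˢ (univ : Set (EuclideanSpace ℝ (Fin 3))))] 0 := by
  -- ### a classical pressure for the profile (far-past extension)
  obtain ⟨P', hprof⟩ := exists_isSelfSimilarEulerProfile hρ hT₁ hTT₁ hsw.distributional hu hp hV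
  -- ### the vortical point, its level, and the clock at that point
  obtain ⟨x₁, hx₁, h, hh, hper, hfast, henv⟩ := hB P' hprof
  have hclock := DriftClock.powerClockAt_of_perigee_fast_envelope hρ hρh hprof hx₁ hh hper hfast henv
  -- ### «one clocked ball kills» (past twin)
  exact NeedleRace.selfSimilar_ae_eq_zero_of_localPowerClockC2_past hρ hρh hT₁ hTT₁ x₀ hsw hH hgauge hu hp hV
    (fun c' hc' => ⟨x₁, hclock c' hc'⟩)

end Past

end Summit.NavierStokesRegularity.NavierStokesRegularity.Theorems.PowerGaugeEulerLiouville

end
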